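import Literature.Barriers.RiemannHypothesis.MollifierLimitations
import Literature.NumberTheory.LFunctions.ZeroStatistics
import HarnessLib

/-!
# Radziwiłł (2012), Theorem 3: on RH the mollification defect of any mollifier of length `T^θ` is
# at least `(½ + ∫₁^{1+θ+ε} F(α,T) dα)⁻¹` — mollifier LENGTH against the pair-correlation mass
# of the zeros on the scale `[1, 1+θ]`

LABEL (cell `landau-siegel`, §C literature harvest, topic r5; bears_on F-S3 §C, START-HERE for
§B-ell / §E): the printed QUANTITATIVE coupling between the length `θ` of a mollifier and the
distribution of zero SPACINGS (Montgomery's form factor `F(α,T)` on `1 ≤ α ≤ 1 + θ`), conditional on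
RH. It extends the tree's barrier entry `Literature.Barriers.RiemannHypothesis.MollifierLimitations`
(Radziwiłł's UNCONDITIONAL Theorem 1 `Radziwill2012_thm1`, Prop. A/B, Lemma 5 in
`MollifierLimitationsProofs.lean`), whose vocabulary (`mollificationDefect`, `dirichletMollifier`) is
CITED here; it is not itself filed as a barrier (conditional statement). «The programme SEARCHES
and TYPES; no claim about Landau–Siegel zeros, Theorems 1–2 of arXiv:2211.02515 or a repaired
Margin232 until a kernel theorem says so.»

Topic `Literature/NumberTheory/LFunctions` (namespace `Literature.NumberTheory.LFunctions`; the
dyadic form factor in the sub-namespace `Radziwill2012`). STATEMENT LAYER (D-0014): ONE named fact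
(Theorem 3) over one honest definition (the DYADIC form factor of the paper, built from the tree's
ordinates `zetaOrdinate` and weight `montgomeryWeight`; Montgomery's own `F` over `0 < γ ≤ T` is the
tree's `montgomeryFormFactor`, a different window).

## What the source prints (held text `paper:arxiv-1207.6583`, corpus-tex chunks p0003–p0004, read
## 2026-08-26)

M. Radziwiłł, *Limitations to mollifying `ζ(s)`*, arXiv:1207.6583 (2012), unpublished manuscript
[Radziwill2012]. Standing data (1) = (DirR): `M_θ(s) = Σ_{n ≤ T^θ} a(n) n^{−s}` with `a(n) ≪ n^ε` and
`a(1) = 1`; `𝓘(M_θ) := T⁻¹ ∫_T^{2T} |1 − ζ(½+it) M_θ(½+it)|² dt`.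

p0004: «On the Riemann Hypothesis we obtain an analogue of Proposition A involving Montgomery's
Pair Correlation function,
`F(α, T) := (2π/(T log T)) Σ_{T ≤ γ, γ′ ≤ 2T} T^{iα(γ − γ′)} · w(γ − γ′)` where `w(x) = 4/(4 + x²)`.
… Following Montgomery it is well known that `F(α,T) = α + o(1)` for `ε ≤ α ≤ 1` and
`F(α,T) ≥ o(1)` for all `α`. The Pair Correlation Conjecture is equivalent to `F(α,T) = 1 + o(1)` in
`1 ≤ α ≤ M` for every fixed `M > 1`. Theorem 2 follows from Theorem 3 below.»

> **Theorem 3.** Let `θ > 0` be given. Assume the Riemann Hypothesis. Let `M_θ` be as in (1) and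
> assume in addition that `a(p^k) ≪ 1`. Then, for `T` large,
> `𝓘(M_θ) = T⁻¹ ∫_T^{2T} |1 − ζ(½+it)M_θ(½+it)|² dt ≥ (½ + ∫₁^{1+θ+ε} F(α,T) dα)⁻¹`.

«Remark. As in Theorem 2 the requirement `a(p^k) ≪ 1` can be dispensed with.» «In Theorem 3,
choosing `M_θ = 𝓛_θ` for `θ < 4/7` and applying Conrey's result we have `𝓘(𝓛_θ) ∼ 1/θ` for
`½ < θ < 4/7` and thus `∫₁^{1+θ} F(α,T) dα > θ − ½ + o(1)`.» (**Theorem 2**, p0003: RH + Pair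
Correlation Conjecture ⇒ `𝓘(M_θ) ≥ (1 + o_θ(1))/(0.5 + θ)` — the corollary of Theorem 3 with
`F = 1 + o(1)` on `[1, 1+θ+ε]`; not typed separately.) «The size of `𝓘(M_θ)` depends on the
distribution of the zeros of `ζ(s)` in small intervals of length `2π/((1+θ) log T)` around zeros of
`ζ(s)`. When `θ` is large, the Pair Correlation Conjecture allows to control the number of zeros in
such thin intervals» (p0003).

## Lean rendering / design choices (audit notes for ls-lit-ref)

* `𝓘`, `M_θ`, the coefficient conditions `a(1) = 1`, `a(n) ≪ n^ε` (a budget `C : ℝ → ℝ`): exactly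
  as in the tree's `Radziwill2012_thm1` (`mollificationDefect (dirichletMollifier a ⌊T^θ⌋₊) T`). The
  extra hypothesis `a(p^k) ≪ 1` is kept AS PRINTED (a bound `B` on `‖a(p^k)‖`, `p` prime, `k ≥ 1`),
  although the Remark says it can be dropped — the typed statement is the weaker, printed one.
* `F(α,T)` with the DYADIC window `T ≤ γ, γ′ ≤ 2T`: `Radziwill2012.dyadicFormFactor α T`, a finite
  sum over pairs of indices `n` with `T ≤ γ_n ≤ 2T` (`zetaOrdinate`, `zeroIndexSet (2T)` filtered;
  zeros counted with multiplicity as everywhere in the pair-correlation literature), the general term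
  written `cos(α log T (γ−γ′)) w(γ−γ′)` (the sum is real by the symmetry `γ ↔ γ′`, as for the tree's
  `montgomeryFormFactor`). Under RH — the standing hypothesis of the theorem — these `γ` are the
  ordinates of ALL zeros at that height.
* «for `T` large» may depend on `θ`, `ε`, the budget `C` and the bound `B`; `ε > 0` is arbitrary
  (it enters only through the upper limit `1 + θ + ε`). Quantifier order:
  `RH → ∀ θ > 0, ∀ ε > 0, ∀ C, ∀ B, ∃ T₀, ∀ T ≥ T₀, ∀ a, … → (½ + ∫₁^{1+θ+ε} F)⁻¹ ≤ 𝓘`.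

## References

* M. Radziwiłł, arXiv:1207.6583 (2012): §1 (1), Theorem 2, Theorem 3 and the Remarks after them,
  Proposition A. [Radziwill2012]
* H. L. Montgomery, Proc. Sympos. Pure Math. 24 (1973), §1 (1) — tree `montgomeryFormFactor`,
  `montgomeryWeight` (`ZeroStatistics.lean`). [Montgomery1973]
* Tree: `Literature/Barriers/RiemannHypothesis/MollifierLimitations.lean` (`Radziwill2012_thm1`,
  `mollificationDefect`, `dirichletMollifier`), `MollifierLimitationsProofs.lean`
  (`Radziwill2012_propA`, `Radziwill2012_lemma5`, `Radziwill2012_propB`).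
-/

noncomputable section

open Real MeasureTheory intervalIntegral Finset
open Literature.Barriers.RiemannHypothesis

namespace Literature.NumberTheory.LFunctions

namespace Radziwill2012

/-- The pairs of (indices of) ordinates in the dyadic window: `T ≤ γ_m, γ_n ≤ 2T`, zeros counted
with multiplicity (indices `n < N(2T)` with `T ≤ γ_n`). [cite: Radziwill2012, §1 (definition of F(α,T), p. 4)] -/
def dyadicZeroPairs (T : ℝ) : Finset (ℕ × ℕ) :=
  ((zeroIndexSet (2 * T)).filter fun n ↦ T ≤ zetaOrdinate n) ×ˢ
    ((zeroIndexSet (2 * T)).filter fun n ↦ T ≤ zetaOrdinate n)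

/-- Radziwiłł's (dyadic) form factor
`F(α,T) = (2π/(T log T)) Σ_{T ≤ γ,γ′ ≤ 2T} T^{iα(γ−γ′)} w(γ−γ′)`, `w(x) = 4/(4+x²)`, written with the
real general term `cos(α log T (γ−γ′)) w(γ−γ′)`. [cite: Radziwill2012, §1 (definition of F(α,T), p. 4)] -/
def dyadicFormFactor (α T : ℝ) : ℝ :=
  2 * π / (T * Real.log T) * ∑ p ∈ dyadicZeroPairs T,
    Real.cos (α * Real.log T * (zetaOrdinate p.1 - zetaOrdinate p.2)) *
      montgomeryWeight (zetaOrdinate p.1 - zetaOrdinate p.2)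

/-- `F(−α,T) = F(α,T)` (the `cos` form). [cite: Radziwill2012, §1 (p. 4, after the definition)] -/
theorem dyadicFormFactor_neg (α T : ℝ) : dyadicFormFactor (-α) T = dyadicFormFactor α T := by
  simp [dyadicFormFactor]

end Radziwill2012

open Radziwill2012

/-- **Radziwiłł 2012, Theorem 3** (on RH: the mollification defect against the pair-correlation
mass on `[1, 1+θ]`). Assume the Riemann Hypothesis. Let `θ > 0`, `ε > 0`, a growth budget
`C : ℝ → ℝ` and a bound `B`. Then for all large `T` and every coefficient sequence `a` with
`a(1) = 1`, `‖a(n)‖ ≤ C(ε′) n^{ε′}` (all `ε′ > 0`, `n ≥ 1`) and `‖a(p^k)‖ ≤ B` (`p` prime, `k ≥ 1`),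
the mollifier `M_θ(s) = Σ_{n ≤ T^θ} a(n) n^{−s}` satisfies
`𝓘(M_θ) = T⁻¹∫_T^{2T} |1 − ζ(½+it)M_θ(½+it)|² dt ≥ (½ + ∫₁^{1+θ+ε} F(α,T) dα)⁻¹`,
`F` = Radziwiłł's dyadic form factor (Theorem 2 of the paper is the corollary obtained by
inserting `F = 1 + o(1)` on `[1, 1+θ+ε]`; see the module docstring). Status: theorem-in-print
(an implication with the Riemann Hypothesis as antecedent, exactly as printed; arXiv manuscript).
[cite: Radziwill2012, Theorem 3] -/
def radziwill2012_theorem3 : Prop :=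
  RiemannHypothesis →
    ∀ θ : ℝ, 0 < θ → ∀ ε : ℝ, 0 < ε → ∀ C : ℝ → ℝ, ∀ B : ℝ,
      ∃ T₀ : ℝ, ∀ T : ℝ, T₀ ≤ T →
        ∀ a : ℕ → ℂ, a 1 = 1 →
          (∀ ε' : ℝ, 0 < ε' → ∀ n : ℕ, 1 ≤ n → ‖a n‖ ≤ C ε' * (n : ℝ) ^ ε') →
          (∀ p k : ℕ, p.Prime → 1 ≤ k → ‖a (p ^ k)‖ ≤ B) →
            (1 / 2 + ∫ α in (1 : ℝ)..(1 + θ + ε), dyadicFormFactor α T)⁻¹ ≤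
              mollificationDefect (dirichletMollifier a ⌊T ^ θ⌋₊) T

end Literature.NumberTheory.LFunctions
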